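import Mathlib.Analysis.SpecialFunctions.Pow.Real
import Mathlib.Algebra.Order.BigOperators.Group.Finset
import Mathlib.Tactic
import HarnessLib

/-!
# The fork at [IUTchIII] Cor. 3.12 — the (j,p)-PACKET competition between summands (real-number shadow of XXVI/XXVIc)

Record-only support file (D-0012) of the abc-iut cell (wave-4 prover abc-iut-w4-d096, gen 2); TAKES NO SIDE on
[IUTchIII] Cor. 3.12 and types no reading of it. It records, as kernel arithmetic, the note posted on the cell's STATUS
board 2026-08-26T02:49Z about the PER-PACKET volume reading R0 at a `(j, v_ℚ = p)`-packet with SEVERAL places over `p`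
(skeleton memo HOME/skel/FORK-REAL-MODEL.md §2: "with several places over p the packet reading is a signed weighted sum of
summand comparisons … NOT settled by XXVI/XXVIb").

SETTING (abstract, so that nothing of the real packet is restated): a finite index type `E` of summands `v⃗ ∈ 𝕍_p^{j+1}`,
nonnegative weights `w` ([IUTchIII] Rmk. 3.1.1 (ii)), the q-pilot log-volume `q e` and the Θ-hull log-volume `h e` of each
summand, a depth `Q ≥ 0` (`Q = −log‖q̲_v‖` at the bad place `v`), the label `j`, and a three-way classification of summands
read off the kernel theorems of the skeleton seat (abc-iut-skel): 
* `good e` (last slot a good place): `q e = 0`, `0 ≤ h e` (XXVIc `thetaHull_contains_O`: a unit slot puts `O_{v⃗}` in the hull);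
* `mixed e` (last slot the bad place, some slot good): `q e = −Q`, `0 ≤ h e` (XXVIc again);
* `diag e` (every slot the bad place): `q e = −Q`, `−j²·Q ≤ h e` (the bare Θ-region `ι(q̲^{j²})·O` lies in its hull; XXVI
  `thetaHull_bound` gives the matching UPPER bound `h e ≤ −j²Q + D_e`).
RESULTS (`Summit.ABC.IUTFork.PacketCompetition.*`, no definitions): the weighted packet surplus `S := Σ_e w_e·(h_e − q_e)` satisfies
`S ≥ Q·(W_mixed − (j² − 1)·W_diag)` (`surplus_ge`), hence the packet reading `Σ w·q ≤ Σ w·h` HOLDS whenever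
`(j² − 1)·W_diag ≤ W_mixed` (`reading_of_weights`); conversely with the per-summand UPPER bounds (`h ≤ D` off the diagonal,
`h ≤ −j²Q + D` on it) `S ≤ Q·(W_mixed − (j² − 1)·W_diag) + D·W` (`surplus_le`), so the reading FAILS once
`W_mixed < (j² − 1)·W_diag` and `Q` is deep enough (`not_reading_of_weights_of_deep`). With ONE bad place `v` (degree
`d_v`) and good places of total degree `d_g` over `p` and the product weights, `W_mixed = d_v·((d_v+d_g)^j − d_v^j)` and
`W_diag = d_v^{j+1}`, so the sign is that of `(d_v + d_g)^j − j²·d_v^j` (`sign_criterion`): equal degrees give `2^j` versus `j²`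
— TRUE at every `j ≠ 3`, tie at `j = 2, 4` (`sq_le_two_pow_iff`), FALSE at `j = 3` for deep `Q`; `d_g ≥ 2·d_v` makes it true at
every `j` (`criterion_of_two_le_ratio`, via `j² ≤ 3^j`; the sharp threshold `(1 + d_g/d_v)^3 ≥ 9`, i.e. `d_g/d_v ≥ 9^{1/3} − 1 ≈ 1.08`,
is an arithmetic remark not formalised here). So the per-packet reading is decided packet by packet by place combinatorics — an
artefact of the (stronger-than-print) per-packet level, as the skeleton memo says; nothing here is about the printed global
inequality `Cor312.Setting.Statement`. [folklore]
-/

namespace Summit.ABC.IUTFork.PacketCompetition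

open Finset

variable {E : Type*} [Fintype E] (w q h : E → ℝ) (good mixed diag : E → Prop)
  [DecidablePred good] [DecidablePred mixed] [DecidablePred diag] (Q D : ℝ) (j : ℕ)

/-! Notation used in the statements (no definitions are introduced): the packet SURPLUS is `Σ_e w_e·(h_e − q_e)`, the
weight of a class `c` of summands is `Σ_{e ∈ c} w_e`; the per-packet volume reading R0 at `(j, p)` is `Σ w·q ≤ Σ w·h`. -/

omit [DecidablePred good] in
/-- **Lower bound for the packet surplus.** If every summand is good, mixed or diagonal (pairwise exclusively), with the
per-summand facts of the module docstring, then `S ≥ Q·W_mixed − (j² − 1)·Q·W_diag`. [folklore] -/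
theorem surplus_ge (hw : ∀ e, 0 ≤ w e)
    (hcover : ∀ e, good e ∨ mixed e ∨ diag e) (hgm : ∀ e, good e → ¬ mixed e) (hgd : ∀ e, good e → ¬ diag e)
    (hmd : ∀ e, mixed e → ¬ diag e)
    (hgood : ∀ e, good e → q e = 0 ∧ 0 ≤ h e) (hmixed : ∀ e, mixed e → q e = -Q ∧ 0 ≤ h e)
    (hdiag : ∀ e, diag e → q e = -Q ∧ -((j : ℝ) ^ 2 * Q) ≤ h e) :
    Q * (∑ e ∈ univ.filter mixed, w e) - ((j : ℝ) ^ 2 - 1) * Q * (∑ e ∈ univ.filter diag, w e) ≤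
      ∑ e, w e * (h e - q e) := by
  classical
  -- pointwise lower bound: `0` on good, `Q` on mixed, `−(j²−1)Q` on diagonal summands
  let lb : E → ℝ := fun e => if diag e then -(((j : ℝ) ^ 2 - 1) * Q) else if mixed e then Q else 0
  have hpt : ∀ e, lb e ≤ h e - q e := by
    intro e
    simp only [lb]
    rcases hcover e with hg | hm | hd
    · rw [if_neg (hgd e hg), if_neg (hgm e hg)]
      obtain ⟨hq, hh⟩ := hgood e hg
      rw [hq]; linarith
    · rw [if_neg (hmd e hm), if_pos hm]
      obtain ⟨hq, hh⟩ := hmixed e hm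
      rw [hq]; linarith
    · rw [if_pos hd]
      obtain ⟨hq, hh⟩ := hdiag e hd
      rw [hq]; nlinarith
  -- sum with the nonnegative weights
  have hsum : ∑ e, w e * lb e ≤ ∑ e, w e * (h e - q e) :=
    Finset.sum_le_sum fun e _ => mul_le_mul_of_nonneg_left (hpt e) (hw e)
  -- evaluate the left-hand side
  have hlhs : ∑ e, w e * lb e =
      Q * (∑ e ∈ univ.filter mixed, w e) - ((j : ℝ) ^ 2 - 1) * Q * (∑ e ∈ univ.filter diag, w e) := by
    simp only [lb]
    rw [Finset.mul_sum, Finset.mul_sum, Finset.sum_filter, Finset.sum_filter, ← Finset.sum_sub_distrib]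
    refine Finset.sum_congr rfl fun e _ => ?_
    by_cases hd : diag e
    · have hm : ¬ mixed e := fun hm => hmd e hm hd
      simp [hd, hm]; ring
    · by_cases hm : mixed e
      · simp [hd, hm]; ring
      · simp [hd, hm]
  linarith

omit [DecidablePred good] in
/-- **The packet reading HOLDS when the mixed summands outweigh the diagonal**: if `(j² − 1)·W_diag ≤ W_mixed` and `Q ≥ 0`,
then `Σ w·q ≤ Σ w·h` — however deep the bad place is. [folklore] -/
theorem reading_of_weights (hw : ∀ e, 0 ≤ w e)
    (hcover : ∀ e, good e ∨ mixed e ∨ diag e) (hgm : ∀ e, good e → ¬ mixed e) (hgd : ∀ e, good e → ¬ diag e)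
    (hmd : ∀ e, mixed e → ¬ diag e)
    (hgood : ∀ e, good e → q e = 0 ∧ 0 ≤ h e) (hmixed : ∀ e, mixed e → q e = -Q ∧ 0 ≤ h e)
    (hdiag : ∀ e, diag e → q e = -Q ∧ -((j : ℝ) ^ 2 * Q) ≤ h e)
    (hQ : 0 ≤ Q) (hweights : ((j : ℝ) ^ 2 - 1) * (∑ e ∈ univ.filter diag, w e) ≤ ∑ e ∈ univ.filter mixed, w e) :
    ∑ e, w e * q e ≤ ∑ e, w e * h e := by
  have h1 := surplus_ge w q h good mixed diag Q j hw hcover hgm hgd hmd hgood hmixed hdiag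
  have h2 : 0 ≤ Q * (∑ e ∈ univ.filter mixed, w e) - ((j : ℝ) ^ 2 - 1) * Q * (∑ e ∈ univ.filter diag, w e) := by
    have : 0 ≤ Q * ((∑ e ∈ univ.filter mixed, w e) - ((j : ℝ) ^ 2 - 1) * (∑ e ∈ univ.filter diag, w e)) :=
      mul_nonneg hQ (by linarith)
    linarith
  have h3 : ∑ e, w e * (h e - q e) = ∑ e, w e * h e - ∑ e, w e * q e := by
    rw [← Finset.sum_sub_distrib]
    exact Finset.sum_congr rfl fun e _ => by ring
  linarith

omit [DecidablePred good] in
/-- **Upper bound for the packet surplus** from the per-summand UPPER bounds (XXVI `thetaHull_bound`: `h ≤ D` off the diagonal,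
`h ≤ −j²·Q + D` on it, `D ≥` the [IUTchIV] Prop. 1.4 discrepancy of every summand): `S ≤ Q·W_mixed − (j² − 1)·Q·W_diag + D·W`.
[folklore] -/
theorem surplus_le (hw : ∀ e, 0 ≤ w e)
    (hcover : ∀ e, good e ∨ mixed e ∨ diag e) (hgm : ∀ e, good e → ¬ mixed e) (hgd : ∀ e, good e → ¬ diag e)
    (hmd : ∀ e, mixed e → ¬ diag e)
    (hgood : ∀ e, good e → q e = 0 ∧ h e ≤ D) (hmixed : ∀ e, mixed e → q e = -Q ∧ h e ≤ D)
    (hdiag : ∀ e, diag e → q e = -Q ∧ h e ≤ -((j : ℝ) ^ 2 * Q) + D) :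
    ∑ e, w e * (h e - q e) ≤
      Q * (∑ e ∈ univ.filter mixed, w e) - ((j : ℝ) ^ 2 - 1) * Q * (∑ e ∈ univ.filter diag, w e) + D * ∑ e, w e := by
  classical
  let lb : E → ℝ := fun e => if diag e then -(((j : ℝ) ^ 2 - 1) * Q) else if mixed e then Q else 0
  have hpt : ∀ e, h e - q e ≤ lb e + D := by
    intro e
    simp only [lb]
    rcases hcover e with hg | hm | hd
    · rw [if_neg (hgd e hg), if_neg (hgm e hg)]
      obtain ⟨hq, hh⟩ := hgood e hg
      rw [hq]; linarith
    · rw [if_neg (hmd e hm), if_pos hm]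
      obtain ⟨hq, hh⟩ := hmixed e hm
      rw [hq]; linarith
    · rw [if_pos hd]
      obtain ⟨hq, hh⟩ := hdiag e hd
      rw [hq]; nlinarith
  have hsum : ∑ e, w e * (h e - q e) ≤ ∑ e, w e * (lb e + D) :=
    Finset.sum_le_sum fun e _ => mul_le_mul_of_nonneg_left (hpt e) (hw e)
  have hlhs : ∑ e, w e * (lb e + D) =
      Q * (∑ e ∈ univ.filter mixed, w e) - ((j : ℝ) ^ 2 - 1) * Q * (∑ e ∈ univ.filter diag, w e) + D * ∑ e, w e := by
    simp only [lb]
    rw [Finset.mul_sum, Finset.mul_sum, Finset.mul_sum, Finset.sum_filter, Finset.sum_filter, ← Finset.sum_sub_distrib,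
      ← Finset.sum_add_distrib]
    refine Finset.sum_congr rfl fun e _ => ?_
    by_cases hd : diag e
    · have hm : ¬ mixed e := fun hm => hmd e hm hd
      simp [hd, hm]; ring
    · by_cases hm : mixed e
      · simp [hd, hm]; ring
      · simp [hd, hm]; ring
  linarith

omit [DecidablePred good] in
/-- **The packet reading FAILS when the diagonal outweighs the mixed summands and the bad place is deep**: if
`W_mixed < (j² − 1)·W_diag` and `Q·((j² − 1)·W_diag − W_mixed) > D·W`, then `Σ w·h < Σ w·q`. [folklore] -/
theorem not_reading_of_weights_of_deep (hw : ∀ e, 0 ≤ w e)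
    (hcover : ∀ e, good e ∨ mixed e ∨ diag e) (hgm : ∀ e, good e → ¬ mixed e) (hgd : ∀ e, good e → ¬ diag e)
    (hmd : ∀ e, mixed e → ¬ diag e)
    (hgood : ∀ e, good e → q e = 0 ∧ h e ≤ D) (hmixed : ∀ e, mixed e → q e = -Q ∧ h e ≤ D)
    (hdiag : ∀ e, diag e → q e = -Q ∧ h e ≤ -((j : ℝ) ^ 2 * Q) + D)
    (hdeep : D * ∑ e, w e <
      Q * (((j : ℝ) ^ 2 - 1) * (∑ e ∈ univ.filter diag, w e) - ∑ e ∈ univ.filter mixed, w e)) :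
    ¬ (∑ e, w e * q e ≤ ∑ e, w e * h e) := by
  intro hread
  have h1 := surplus_le w q h good mixed diag Q D j hw hcover hgm hgd hmd hgood hmixed hdiag
  have h3 : ∑ e, w e * (h e - q e) = ∑ e, w e * h e - ∑ e, w e * q e := by
    rw [← Finset.sum_sub_distrib]
    exact Finset.sum_congr rfl fun e _ => by ring
  nlinarith

/-! ## The one-bad-place count: `W_mixed = d_v·((d_v + d_g)^j − d_v^j)`, `W_diag = d_v^{j+1}` -/

/-- **Sign criterion.** With `W_mixed = d_v·((d_v + d_g)^j − d_v^j)` and `W_diag = d_v^{j+1}` (one bad place of degree `d_v`,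
good places of total degree `d_g`, product weights), `(j² − 1)·W_diag ≤ W_mixed ↔ j²·d_v^j ≤ (d_v + d_g)^j` (for `d_v > 0`).
[folklore] -/
theorem sign_criterion {dv dg : ℝ} (hdv : 0 < dv) :
    ((j : ℝ) ^ 2 - 1) * dv ^ (j + 1) ≤ dv * ((dv + dg) ^ j - dv ^ j) ↔ (j : ℝ) ^ 2 * dv ^ j ≤ (dv + dg) ^ j := by
  have hp : dv ^ (j + 1) = dv ^ j * dv := pow_succ dv j
  rw [hp]
  constructor
  · intro h
    have h' : dv * (((j : ℝ) ^ 2 - 1) * dv ^ j) ≤ dv * ((dv + dg) ^ j - dv ^ j) := by linarith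
    have h'' := le_of_mul_le_mul_left h' hdv
    linarith
  · intro h
    have h' : ((j : ℝ) ^ 2 - 1) * dv ^ j ≤ (dv + dg) ^ j - dv ^ j := by linarith
    have h'' := mul_le_mul_of_nonneg_left h' hdv.le
    linarith

/-- Scale-free form of the criterion: `j² ≤ (1 + r)^j ⇒ j²·d_v^j ≤ (d_v + r·d_v)^j` (`r = d_g/d_v`). [folklore] -/
theorem criterion_of_ratio {dv r : ℝ} (hdv : 0 < dv) (h : (j : ℝ) ^ 2 ≤ (1 + r) ^ j) :
    (j : ℝ) ^ 2 * dv ^ j ≤ (dv + r * dv) ^ j := by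
  have : dv + r * dv = dv * (1 + r) := by ring
  rw [this, mul_pow, mul_comm]
  exact mul_le_mul_of_nonneg_left h (pow_nonneg hdv.le j)

/-- **Equal degrees: `2^j` versus `j²`.** For `j ≥ 2`, `j² ≤ 2^j ↔ j ≠ 3` — so with one good and one bad place of equal degree
over `p` the per-packet reading at label `j` holds at EVERY `j ≠ 3` (ties `j = 2, 4` resolved by `D ≥ 0`) and fails at `j = 3`
for a deep bad place. [folklore] -/
theorem sq_le_two_pow_iff {j : ℕ} (hj : 2 ≤ j) : j ^ 2 ≤ 2 ^ j ↔ j ≠ 3 := by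
  constructor
  · rintro h rfl
    norm_num at h
  · intro hne
    -- `j = 2`, `j = 4`, or `j ≥ 5` by induction
    rcases Nat.lt_or_ge j 5 with hlt | hge
    · interval_cases j <;> simp_all
    · -- for `j ≥ 5`: `j² ≤ 2^j`, by induction from `25 ≤ 32`
      suffices H : ∀ n, 5 ≤ n → n ^ 2 ≤ 2 ^ n from H j hge
      intro n hn
      induction n, hn using Nat.le_induction with
      | base => norm_num
      | succ k hk ih =>
        have h2 : (k + 1) ^ 2 ≤ 2 * k ^ 2 := by nlinarith
        calc (k + 1) ^ 2 ≤ 2 * k ^ 2 := h2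
          _ ≤ 2 * 2 ^ k := by omega
          _ = 2 ^ (k + 1) := by ring

/-- The real-number form used by `sign_criterion` at equal degrees `d_g = d_v`: `j²·d_v^j ≤ (d_v + d_v)^j ↔ j² ≤ 2^j`.
[folklore] -/
theorem criterion_equal_degrees_iff {dv : ℝ} (hdv : 0 < dv) :
    (j : ℝ) ^ 2 * dv ^ j ≤ (dv + dv) ^ j ↔ (j : ℝ) ^ 2 ≤ 2 ^ j := by
  have h2 : dv + dv = 2 * dv := by ring
  rw [h2, mul_pow]
  constructor
  · intro h
    exact le_of_mul_le_mul_right h (pow_pos hdv j)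
  · intro h
    exact mul_le_mul_of_nonneg_right h (pow_nonneg hdv.le j)

/-- `j² ≤ 3^j` for every `j`. [folklore] -/
theorem sq_le_three_pow (j : ℕ) : j ^ 2 ≤ 3 ^ j := by
  rcases Nat.lt_or_ge j 2 with hlt | hge
  · interval_cases j <;> norm_num
  · induction j, hge using Nat.le_induction with
    | base => norm_num
    | succ k hk ih =>
      have h2 : (k + 1) ^ 2 ≤ 3 * k ^ 2 := by nlinarith
      calc (k + 1) ^ 2 ≤ 3 * k ^ 2 := h2
        _ ≤ 3 * 3 ^ k := by omega
        _ = 3 ^ (k + 1) := by ring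

/-- **Good places of at least twice the bad degree settle every label**: if `d_g ≥ 2·d_v` (`r ≥ 2`) then `j² ≤ (1 + r)^j` for
EVERY `j`, so (`criterion_of_ratio`, `sign_criterion`, `reading_of_weights`) the per-packet reading holds at every label `j` and
every depth. [folklore] -/
theorem criterion_of_two_le_ratio {r : ℝ} (hr : 2 ≤ r) (j : ℕ) : (j : ℝ) ^ 2 ≤ (1 + r) ^ j := by
  have h3 : (3 : ℝ) ^ j ≤ (1 + r) ^ j := pow_le_pow_left₀ (by norm_num) (by linarith) j
  have hsq : ((j : ℝ)) ^ 2 ≤ (3 : ℝ) ^ j := by exact_mod_cast sq_le_three_pow j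
  exact hsq.trans h3

end Summit.ABC.IUTFork.PacketCompetition
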